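import Summits.AtomisticToContinuum.FouriersLaw.Theorems.BondHeatUncertaintyLightConeBondHeatStatics

/-!
# No odd small-range charges for the pinned anharmonic chain — high moments

Support file for item `stmt-AtomisticToContinuum-13514` (`HiddenChargeMazur.NoOddChargeSmallRange`),
analytic half: `N`-uniform statics of the Gibbs weight `e^{-H/T}` of `pinnedChain ω₂ lam β γ`.

Arbitrary coordinate powers are dominated by powers of the energy, hence integrable against `e^{-H/T}`;
the position virial identity `∫ q_i^n ∂_iH ρ = nT ∫ q_i^{n-1} ρ` for every `n`; the odd-power virial
inequality `lam ∑ q_i^{2m+4} ≤ ∑ q_i^{2m+1} ∂_iH` (bond terms pair to `V'(b−a)(b^{2m+1} − a^{2m+1}) ≥ 0`);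
the resulting moment chain and the EXTENSIVE sixteenth moments `∑_i ∫ q_i^{16} ρ ≤ 585 T⁴/lam⁴ · N Z`;
the Gaussian recursion for momentum moments of every order.
-/

noncomputable section

open MeasureTheory
open scoped BigOperators
open Literature.MathematicalPhysics.KineticTheory.HeatConduction
open Summit.AtomisticToContinuum.FouriersLaw.Theorems.SubdiffusiveBondHeat
open Summit.AtomisticToContinuum.FouriersLaw.Theorems.LightConeBondHeat

namespace Summit.AtomisticToContinuum.FouriersLaw.Theorems.NoOddCharge

variable {N : ℕ}

section Pinned

variable {ω₂ lam β : ℝ}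

/-! ### Pointwise domination of arbitrary coordinate powers by powers of the energy -/

/-- `|t|^n ≤ R^n` whenever `t⁴ ≤ R` and `1 ≤ R`. [folklore] -/
theorem abs_pow_le_of_pow_four_le {t R : ℝ} (h4 : t ^ 4 ≤ R) (hR : 1 ≤ R) (n : ℕ) : |t| ^ n ≤ R ^ n := by
  have h4' : |t| ^ 4 ≤ R := by
    rw [← abs_pow, abs_of_nonneg (by positivity)]
    exact h4
  have ht : |t| ≤ R := by
    rcases le_or_gt |t| 1 with h | h
    · exact h.trans hR
    · exact (le_self_pow₀ h.le (by norm_num : (4:ℕ) ≠ 0)).trans h4'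
  exact pow_le_pow_left₀ (abs_nonneg _) ht n

/-- `|q_i^n| ≤ (1 + 4/lam)^n (1+H)^n` for the pinned chain (`lam > 0`). [folklore] -/
theorem pinnedChain_abs_position_pow_le_pow (hω : 0 ≤ ω₂) (hl : 0 < lam) (hβ : 0 ≤ β) (γ : ℝ) (N : ℕ)
    (x : PhaseSpace N) (i : Fin N) (n : ℕ) :
    |x.1 i ^ n| ≤ (1 + 4 / lam) ^ n * (1 + (pinnedChain ω₂ lam β γ).hamiltonian N x) ^ n := by
  have h4 := pinnedChain_abs_position_pow_le hω hl hβ γ N x i (le_refl 4)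
  rw [abs_of_nonneg (by positivity)] at h4
  have hH0 := pinnedChain_hamiltonian_nonneg hω hl.le hβ γ N x
  have hR : 1 ≤ (1 + 4 / lam) * (1 + (pinnedChain ω₂ lam β γ).hamiltonian N x) := by
    have h1 : (1:ℝ) ≤ 1 + 4 / lam := le_add_of_nonneg_right (by positivity)
    nlinarith
  rw [abs_pow, ← mul_pow]
  exact abs_pow_le_of_pow_four_le h4 hR n

/-- `|p_i^n| ≤ 4^n (1+H)^{2n}` for the pinned chain. [folklore] -/
theorem pinnedChain_abs_momentum_pow_le_pow (hω : 0 ≤ ω₂) (hl : 0 ≤ lam) (hβ : 0 ≤ β) (γ : ℝ) (N : ℕ)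
    (x : PhaseSpace N) (i : Fin N) (n : ℕ) :
    |x.2 i ^ n| ≤ 4 ^ n * (1 + (pinnedChain ω₂ lam β γ).hamiltonian N x) ^ (2 * n) := by
  have h4 := pinnedChain_abs_momentum_pow_le hω hl hβ γ N x i (le_refl 4)
  rw [abs_of_nonneg (by positivity)] at h4
  have hH0 := pinnedChain_hamiltonian_nonneg hω hl hβ γ N x
  have hR : 1 ≤ 4 * (1 + (pinnedChain ω₂ lam β γ).hamiltonian N x) ^ 2 := by nlinarith
  rw [abs_pow, pow_mul, ← mul_pow]
  exact abs_pow_le_of_pow_four_le h4 hR n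

/-- `q_i^n e^{-H/T} ∈ L¹` for every `n` (`lam > 0`, `T > 0`). [folklore] -/
theorem pinnedChain_integrable_position_pow_mul_gibbsDensity' (hω : 0 < ω₂) (hl : 0 < lam) (hβ : 0 ≤ β)
    (γ : ℝ) (N : ℕ) {T : ℝ} (hT : 0 < T) (i : Fin N) (n : ℕ) :
    Integrable fun x => x.1 i ^ n * (pinnedChain ω₂ lam β γ).gibbsDensity N T x := by
  exact pinnedChain_integrable_mul_gibbsDensity_of_le_pow hω hl.le hβ γ N hT n (by fun_prop)
    (C := (1 + 4 / lam) ^ n) fun x => pinnedChain_abs_position_pow_le_pow hω.le hl hβ γ N x i n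

/-- `p_i^n e^{-H/T} ∈ L¹` for every `n` (`T > 0`). [folklore] -/
theorem pinnedChain_integrable_momentum_pow_mul_gibbsDensity' (hω : 0 < ω₂) (hl : 0 ≤ lam) (hβ : 0 ≤ β)
    (γ : ℝ) (N : ℕ) {T : ℝ} (hT : 0 < T) (i : Fin N) (n : ℕ) :
    Integrable fun x => x.2 i ^ n * (pinnedChain ω₂ lam β γ).gibbsDensity N T x := by
  exact pinnedChain_integrable_mul_gibbsDensity_of_le_pow hω hl hβ γ N hT (2 * n) (by fun_prop)
    (C := 4 ^ n) fun x => pinnedChain_abs_momentum_pow_le_pow hω.le hl hβ γ N x i n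

/-! ### Position virial identity for all powers -/

/-- **Position virial identity** for every `n ≥ 1`:
`∫ q_i^n ∂_{q_i}H e^{-H/T} = n T ∫ q_i^{n-1} e^{-H/T}`. [folklore] -/
theorem pinnedChain_integral_position_pow_mul_partialQ' (hω : 0 < ω₂) (hl : 0 < lam) (hβ : 0 ≤ β) (γ : ℝ)
    (N : ℕ) {T : ℝ} (hT : 0 < T) (i : Fin N) (n : ℕ) :
    ∫ x, x.1 i ^ n * partialQ i ((pinnedChain ω₂ lam β γ).hamiltonian N) x *
        (pinnedChain ω₂ lam β γ).gibbsDensity N T x =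
      T * n * ∫ x, x.1 i ^ (n - 1) * (pinnedChain ω₂ lam β γ).gibbsDensity N T x := by
  set P := pinnedChain ω₂ lam β γ with hP
  have hH1 : ContDiff ℝ 1 (P.hamiltonian N) := pinnedChain_contDiff_hamiltonian ω₂ lam β γ N
  have hHd : Differentiable ℝ (P.hamiltonian N) := hH1.differentiable one_ne_zero
  have hWc : Continuous (partialQ i (P.hamiltonian N)) := P.continuous_partialQ_hamiltonian hH1 i
  set CN : ℝ := N * (ω₂ / 2 + 3 + lam / ω₂ + N ^ 2 * (3 + β)) with hCN
  have hpow_int : ∀ m : ℕ, Integrable fun x => x.1 i ^ m * P.gibbsDensity N T x := fun m =>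
    pinnedChain_integrable_position_pow_mul_gibbsDensity' hω hl hβ γ N hT i m
  have hFg' : Integrable fun x => x.1 i ^ n * (-(partialQ i (P.hamiltonian N) x / T) * P.gibbsDensity N T x) := by
    have h := pinnedChain_integrable_mul_gibbsDensity_of_le_pow hω hl.le hβ γ N hT (n + 1)
      (g := fun x => x.1 i ^ n * partialQ i (P.hamiltonian N) x)
      ((by fun_prop : Continuous fun x : PhaseSpace N => x.1 i ^ n).mul hWc)
      (C := (1 + 4 / lam) ^ n * CN) fun x => ?_
    · refine (h.const_mul (-T⁻¹)).congr (Filter.Eventually.of_forall fun x => ?_)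
      simp only
      ring
    · rw [abs_mul]
      have h1 := pinnedChain_abs_position_pow_le_pow hω.le hl hβ γ N x i n
      have h2 := pinnedChain_abs_partialQ_le hω hl.le hβ γ N x i
      have hH0 := pinnedChain_hamiltonian_nonneg hω.le hl.le hβ γ N x
      calc |x.1 i ^ n| * |partialQ i (P.hamiltonian N) x|
          ≤ ((1 + 4 / lam) ^ n * (1 + P.hamiltonian N x) ^ n) * (CN * (1 + P.hamiltonian N x)) :=
            mul_le_mul h1 h2 (abs_nonneg _) (by positivity)
        _ = (1 + 4 / lam) ^ n * CN * (1 + P.hamiltonian N x) ^ (n + 1) := by ring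
  have e := integral_mul_eq_neg_of_hasLineDerivAt_of_integrable
    (F := fun x : PhaseSpace N => x.1 i ^ n)
    (F' := fun x : PhaseSpace N => (n : ℝ) * x.1 i ^ (n - 1))
    (g := P.gibbsDensity N T)
    (g' := fun x => -(partialQ i (P.hamiltonian N) x / T) * P.gibbsDensity N T x)
    (v := ((Pi.single i 1, 0) : PhaseSpace N)) ?_ hFg' (hpow_int n)
    (fun x => hasLineDerivAt_position_pow n x i)
    (fun x => P.hasLineDerivAt_gibbsDensity (P.hasLineDerivAt_hamiltonian_unitQ hHd x i))
  · have lhs : ∫ x, x.1 i ^ n * (-(partialQ i (P.hamiltonian N) x / T) * P.gibbsDensity N T x) =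
        -T⁻¹ * ∫ x, x.1 i ^ n * partialQ i (P.hamiltonian N) x * P.gibbsDensity N T x := by
      rw [← integral_const_mul]
      exact integral_congr_ae (Filter.Eventually.of_forall fun x => by ring)
    have rhs : ∫ x, (n : ℝ) * x.1 i ^ (n - 1) * P.gibbsDensity N T x =
        (n : ℝ) * ∫ x, x.1 i ^ (n - 1) * P.gibbsDensity N T x := by
      rw [← integral_const_mul]
      exact integral_congr_ae (Filter.Eventually.of_forall fun x => by ring)
    rw [lhs, rhs] at e
    have hTne : T ≠ 0 := hT.ne'
    have e2 : T⁻¹ * ∫ x, x.1 i ^ n * partialQ i (P.hamiltonian N) x * P.gibbsDensity N T x =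
        (n : ℝ) * ∫ x, x.1 i ^ (n - 1) * P.gibbsDensity N T x := by linarith
    calc ∫ x, x.1 i ^ n * partialQ i (P.hamiltonian N) x * P.gibbsDensity N T x
        = T * (T⁻¹ * ∫ x, x.1 i ^ n * partialQ i (P.hamiltonian N) x * P.gibbsDensity N T x) := by
          rw [← mul_assoc, mul_inv_cancel₀ hTne, one_mul]
      _ = T * n * ∫ x, x.1 i ^ (n - 1) * P.gibbsDensity N T x := by rw [e2, mul_assoc]
  · exact ((hpow_int (n - 1)).const_mul (n : ℝ)).congr (Filter.Eventually.of_forall fun x => by simp only; ring)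

/-! ### The odd-power virial inequality and the moment chain -/

/-- On a bond: `V'(b − a)(b^{2m+1} − a^{2m+1}) ≥ 0` (`V' = r + βr³`, `β ≥ 0`). [folklore] -/
theorem pinnedChain_deriv_V_mul_odd_pow_sub_nonneg (hβ : 0 ≤ β) (γ : ℝ) (m : ℕ) (a b : ℝ) :
    0 ≤ deriv (pinnedChain ω₂ lam β γ).V (b - a) * (b ^ (2 * m + 1) - a ^ (2 * m + 1)) := by
  rw [pinnedChain_deriv_V]
  have hmono : StrictMono fun t : ℝ => t ^ (2 * m + 1) := Odd.strictMono_pow ⟨m, rfl⟩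
  have hfac : (b - a) + β * (b - a) ^ 3 = (b - a) * (1 + β * (b - a) ^ 2) := by ring
  rw [hfac]
  have hpos : 0 ≤ 1 + β * (b - a) ^ 2 := by positivity
  rcases le_total a b with hab | hab
  · have h1 : 0 ≤ b ^ (2 * m + 1) - a ^ (2 * m + 1) := sub_nonneg.mpr (hmono.monotone hab)
    have h2 : 0 ≤ b - a := sub_nonneg.mpr hab
    positivity
  · have h1 : b ^ (2 * m + 1) - a ^ (2 * m + 1) ≤ 0 := sub_nonpos.mpr (hmono.monotone hab)
    have h2 : b - a ≤ 0 := sub_nonpos.mpr hab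
    have := mul_nonneg_of_nonpos_of_nonpos (mul_nonpos_of_nonpos_of_nonneg h2 hpos) h1
    simpa [mul_assoc] using this

/-- **Odd-power virial inequality (pointwise).** `lam ∑_i q_i^{2m+4} ≤ ∑_i q_i^{2m+1} ∂_{q_i}H`. [folklore] -/
theorem pinnedChain_sum_position_odd_pow_mul_partialQ_ge (hω : 0 ≤ ω₂) (hβ : 0 ≤ β) (lam γ : ℝ) (N : ℕ)
    (m : ℕ) (x : PhaseSpace N) :
    lam * ∑ i, x.1 i ^ (2 * m + 4) ≤
      ∑ i, x.1 i ^ (2 * m + 1) * partialQ i ((pinnedChain ω₂ lam β γ).hamiltonian N) x := by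
  set P := pinnedChain ω₂ lam β γ with hP
  have hUd : Differentiable ℝ P.U := (pinnedChain_contDiff_U ω₂ lam β γ (n := 1)).differentiable one_ne_zero
  have hVd : Differentiable ℝ P.V := (pinnedChain_contDiff_V ω₂ lam β γ (n := 1)).differentiable one_ne_zero
  have h1 : ∀ i, partialQ i (P.hamiltonian N) x = P.dPotential N i x.1 := fun i =>
    P.partialQ_hamiltonian_eq_dPotential hUd hVd N x i
  simp_rw [h1]
  rw [sum_mul_dPotential P N (fun i => x.1 i ^ (2 * m + 1)) x.1]
  have hA : lam * ∑ i, x.1 i ^ (2 * m + 4) ≤ ∑ i, x.1 i ^ (2 * m + 1) * deriv P.U (x.1 i) := by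
    rw [Finset.mul_sum]
    refine Finset.sum_le_sum fun i _ => ?_
    rw [hP, pinnedChain_deriv_U]
    have e1 : x.1 i ^ (2 * m + 1) * (ω₂ * x.1 i + lam * x.1 i ^ 3) =
        ω₂ * (x.1 i ^ (m + 1)) ^ 2 + lam * x.1 i ^ (2 * m + 4) := by ring
    rw [e1]
    nlinarith [mul_nonneg hω (sq_nonneg (x.1 i ^ (m + 1)))]
  have hB : 0 ≤ ∑ k : Fin N, ∑ l : Fin N,
      (if l.val = k.val + 1 then deriv P.V (x.1 l - x.1 k) * (x.1 l ^ (2 * m + 1) - x.1 k ^ (2 * m + 1))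
        else 0) := by
    refine Finset.sum_nonneg fun k _ => Finset.sum_nonneg fun l _ => ?_
    split_ifs
    · exact pinnedChain_deriv_V_mul_odd_pow_sub_nonneg hβ γ m _ _
    · exact le_rfl
  linarith

/-- **The moment chain.** `lam ∑_i ∫ q_i^{2m+4} ρ ≤ (2m+1) T ∑_i ∫ q_i^{2m} ρ`. [folklore] -/
theorem pinnedChain_sum_integral_position_pow_step (hω : 0 < ω₂) (hl : 0 < lam) (hβ : 0 ≤ β) (γ : ℝ) (N : ℕ)
    {T : ℝ} (hT : 0 < T) (m : ℕ) :
    lam * ∑ i : Fin N, ∫ x, x.1 i ^ (2 * m + 4) * (pinnedChain ω₂ lam β γ).gibbsDensity N T x ≤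
      (2 * m + 1) * T * ∑ i : Fin N, ∫ x, x.1 i ^ (2 * m) * (pinnedChain ω₂ lam β γ).gibbsDensity N T x := by
  set P := pinnedChain ω₂ lam β γ with hP
  set ρ := P.gibbsDensity N T with hρ
  have hρ0 : ∀ x, 0 ≤ ρ x := fun x => (P.gibbsDensity_pos N T x).le
  have hH1 : ContDiff ℝ 1 (P.hamiltonian N) := pinnedChain_contDiff_hamiltonian ω₂ lam β γ N
  have hWc : ∀ i, Continuous (partialQ i (P.hamiltonian N)) := fun i => P.continuous_partialQ_hamiltonian hH1 i
  set CN : ℝ := N * (ω₂ / 2 + 3 + lam / ω₂ + N ^ 2 * (3 + β)) with hCN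
  have hI : ∀ i : Fin N, Integrable fun x => x.1 i ^ (2 * m + 1) * partialQ i (P.hamiltonian N) x * ρ x := by
    intro i
    refine pinnedChain_integrable_mul_gibbsDensity_of_le_pow hω hl.le hβ γ N hT (2 * m + 1 + 1)
      ((by fun_prop : Continuous fun x : PhaseSpace N => x.1 i ^ (2 * m + 1)).mul (hWc i))
      (C := (1 + 4 / lam) ^ (2 * m + 1) * CN) fun x => ?_
    rw [abs_mul]
    have h1 := pinnedChain_abs_position_pow_le_pow hω.le hl hβ γ N x i (2 * m + 1)
    have h2 := pinnedChain_abs_partialQ_le hω hl.le hβ γ N x i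
    have hH0 := pinnedChain_hamiltonian_nonneg hω.le hl.le hβ γ N x
    calc |x.1 i ^ (2 * m + 1)| * |partialQ i (P.hamiltonian N) x|
        ≤ ((1 + 4 / lam) ^ (2 * m + 1) * (1 + P.hamiltonian N x) ^ (2 * m + 1)) * (CN * (1 + P.hamiltonian N x)) :=
          mul_le_mul h1 h2 (abs_nonneg _) (by positivity)
      _ = (1 + 4 / lam) ^ (2 * m + 1) * CN * (1 + P.hamiltonian N x) ^ (2 * m + 1 + 1) := by ring
  have hstep : ∀ i : Fin N, ∫ x, x.1 i ^ (2 * m + 1) * partialQ i (P.hamiltonian N) x * ρ x =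
      T * (2 * m + 1 : ℕ) * ∫ x, x.1 i ^ (2 * m) * ρ x := by
    intro i
    have h := pinnedChain_integral_position_pow_mul_partialQ' hω hl hβ γ N hT i (2 * m + 1)
    simpa using h
  have hsum : ∫ x, (∑ i, x.1 i ^ (2 * m + 1) * partialQ i (P.hamiltonian N) x) * ρ x =
      (2 * m + 1) * T * ∑ i, ∫ x, x.1 i ^ (2 * m) * ρ x := by
    rw [integral_sum_mul N (fun i x => x.1 i ^ (2 * m + 1) * partialQ i (P.hamiltonian N) x) ρ hI, Finset.mul_sum]
    refine Finset.sum_congr rfl fun i _ => ?_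
    rw [hstep i]
    push_cast
    ring
  have hint2 : Integrable fun x => (∑ i, x.1 i ^ (2 * m + 1) * partialQ i (P.hamiltonian N) x) * ρ x := by
    simp_rw [Finset.sum_mul]
    exact integrable_finsetSum _ fun i _ => hI i
  have hIp : ∀ i : Fin N, Integrable fun x => x.1 i ^ (2 * m + 4) * ρ x := fun i =>
    pinnedChain_integrable_position_pow_mul_gibbsDensity' hω hl hβ γ N hT i _
  have hint1 : Integrable fun x => (lam * ∑ i, x.1 i ^ (2 * m + 4)) * ρ x := by
    simp_rw [Finset.mul_sum, Finset.sum_mul]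
    refine integrable_finsetSum _ fun i _ => ?_
    exact ((hIp i).const_mul lam).congr (Filter.Eventually.of_forall fun x => by ring)
  have e1 : ∫ x, (lam * ∑ i, x.1 i ^ (2 * m + 4)) * ρ x = lam * ∑ i, ∫ x, x.1 i ^ (2 * m + 4) * ρ x := by
    simp_rw [Finset.mul_sum]
    rw [integral_sum_mul N (fun i x => lam * x.1 i ^ (2 * m + 4)) ρ fun i =>
      ((hIp i).const_mul lam).congr (Filter.Eventually.of_forall fun x => by ring)]
    refine Finset.sum_congr rfl fun i _ => ?_
    rw [← integral_const_mul]
    exact integral_congr_ae (Filter.Eventually.of_forall fun x => by ring)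
  have hle : ∀ x, (lam * ∑ i, x.1 i ^ (2 * m + 4)) * ρ x ≤
      (∑ i, x.1 i ^ (2 * m + 1) * partialQ i (P.hamiltonian N) x) * ρ x := fun x =>
    mul_le_mul_of_nonneg_right (pinnedChain_sum_position_odd_pow_mul_partialQ_ge hω.le hβ lam γ N m x) (hρ0 x)
  rw [← e1, ← hsum]
  exact integral_mono hint1 hint2 hle

/-- **Sixteenth moments are extensive**: `∑_i ∫ q_i^{16} e^{-H/T} ≤ (585 T⁴/lam⁴) · N · ∫ e^{-H/T}`. [folklore] -/
theorem pinnedChain_sum_integral_position_pow_sixteen_le (hω : 0 < ω₂) (hl : 0 < lam) (hβ : 0 ≤ β) (γ : ℝ)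
    (N : ℕ) {T : ℝ} (hT : 0 < T) :
    ∑ i : Fin N, ∫ x, x.1 i ^ 16 * (pinnedChain ω₂ lam β γ).gibbsDensity N T x ≤
      585 * T ^ 4 / lam ^ 4 * N * ∫ x, (pinnedChain ω₂ lam β γ).gibbsDensity N T x := by
  set P := pinnedChain ω₂ lam β γ with hP
  set ρ := P.gibbsDensity N T with hρ
  have h0 := pinnedChain_sum_integral_position_pow_step hω hl hβ γ N hT 0
  have h4 := pinnedChain_sum_integral_position_pow_step hω hl hβ γ N hT 2
  have h8 := pinnedChain_sum_integral_position_pow_step hω hl hβ γ N hT 4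
  have h12 := pinnedChain_sum_integral_position_pow_step hω hl hβ γ N hT 6
  norm_num at h0 h4 h8 h12
  set Z : ℝ := ∫ x, ρ x
  set S4 : ℝ := ∑ i : Fin N, ∫ x, x.1 i ^ 4 * ρ x
  set S8 : ℝ := ∑ i : Fin N, ∫ x, x.1 i ^ 8 * ρ x
  set S12 : ℝ := ∑ i : Fin N, ∫ x, x.1 i ^ 12 * ρ x
  set S16 : ℝ := ∑ i : Fin N, ∫ x, x.1 i ^ 16 * ρ x
  have hl4 : 0 < lam ^ 4 := by positivity
  rw [div_mul_eq_mul_div, div_mul_eq_mul_div, le_div_iff₀ hl4]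
  calc S16 * lam ^ 4 = lam ^ 3 * (lam * S16) := by ring
    _ ≤ lam ^ 3 * (13 * T * S12) := mul_le_mul_of_nonneg_left h12 (by positivity)
    _ = lam ^ 2 * (13 * T) * (lam * S12) := by ring
    _ ≤ lam ^ 2 * (13 * T) * (9 * T * S8) := mul_le_mul_of_nonneg_left h8 (by positivity)
    _ = lam * (13 * T) * (9 * T) * (lam * S8) := by ring
    _ ≤ lam * (13 * T) * (9 * T) * (5 * T * S4) := mul_le_mul_of_nonneg_left h4 (by positivity)
    _ = (13 * T) * (9 * T) * (5 * T) * (lam * S4) := by ring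
    _ ≤ (13 * T) * (9 * T) * (5 * T) * (T * (N * Z)) := mul_le_mul_of_nonneg_left h0 (by positivity)
    _ = 585 * T ^ 4 * N * Z := by ring

/-! ### Gaussian momentum moments of every order -/

/-- **Gaussian recursion** `∫ p_i^{k+2} e^{-H/T} = T(k+1) ∫ p_i^k e^{-H/T}`, every `k`. [folklore] -/
theorem pinnedChain_integral_momentum_pow_add_two' (hω : 0 < ω₂) (hl : 0 ≤ lam) (hβ : 0 ≤ β)
    (γ : ℝ) (N : ℕ) {T : ℝ} (hT : 0 < T) (i : Fin N) (k : ℕ) :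
    ∫ x, x.2 i ^ (k + 2) * (pinnedChain ω₂ lam β γ).gibbsDensity N T x =
      T * (k + 1) * ∫ x, x.2 i ^ k * (pinnedChain ω₂ lam β γ).gibbsDensity N T x := by
  have hint : ∀ m : ℕ, Integrable fun x => x.2 i ^ m * (pinnedChain ω₂ lam β γ).gibbsDensity N T x :=
    fun m => pinnedChain_integrable_momentum_pow_mul_gibbsDensity' hω hl hβ γ N hT i m
  have e := integral_mul_eq_neg_of_hasLineDerivAt_of_integrable
    (F := fun x : PhaseSpace N => x.2 i ^ (k + 1))
    (F' := fun x : PhaseSpace N => ((k + 1 : ℕ) : ℝ) * x.2 i ^ (k + 1 - 1))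
    (g := (pinnedChain ω₂ lam β γ).gibbsDensity N T)
    (g' := fun x => -(x.2 i / T) * (pinnedChain ω₂ lam β γ).gibbsDensity N T x)
    (v := ((0, Pi.single i 1) : PhaseSpace N)) ?_ ?_ ?_
    (fun x => hasLineDerivAt_momentum_pow (k + 1) x i)
    (fun x => (pinnedChain ω₂ lam β γ).hasLineDerivAt_gibbsDensity
      ((pinnedChain ω₂ lam β γ).hasLineDerivAt_hamiltonian_unitP N x i))
  · have lhs : ∫ x, x.2 i ^ (k + 1) *
        (-(x.2 i / T) * (pinnedChain ω₂ lam β γ).gibbsDensity N T x) =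
        -T⁻¹ * ∫ x, x.2 i ^ (k + 2) * (pinnedChain ω₂ lam β γ).gibbsDensity N T x := by
      rw [← integral_const_mul]
      exact integral_congr_ae (Filter.Eventually.of_forall fun x => by ring)
    have rhs : ∫ x, ((k + 1 : ℕ) : ℝ) * x.2 i ^ (k + 1 - 1) *
        (pinnedChain ω₂ lam β γ).gibbsDensity N T x =
        ((k : ℝ) + 1) * ∫ x, x.2 i ^ k * (pinnedChain ω₂ lam β γ).gibbsDensity N T x := by
      rw [← integral_const_mul]
      refine integral_congr_ae (Filter.Eventually.of_forall fun x => ?_)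
      simp only [Nat.add_sub_cancel, Nat.cast_add, Nat.cast_one]
      ring
    rw [lhs, rhs] at e
    have hTne : T ≠ 0 := hT.ne'
    have e2 : T⁻¹ * ∫ x, x.2 i ^ (k + 2) * (pinnedChain ω₂ lam β γ).gibbsDensity N T x =
        ((k : ℝ) + 1) * ∫ x, x.2 i ^ k * (pinnedChain ω₂ lam β γ).gibbsDensity N T x := by linarith
    calc ∫ x, x.2 i ^ (k + 2) * (pinnedChain ω₂ lam β γ).gibbsDensity N T x
        = T * (T⁻¹ * ∫ x, x.2 i ^ (k + 2) * (pinnedChain ω₂ lam β γ).gibbsDensity N T x) := by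
          rw [← mul_assoc, mul_inv_cancel₀ hTne, one_mul]
      _ = T * ((k : ℝ) + 1) * ∫ x, x.2 i ^ k * (pinnedChain ω₂ lam β γ).gibbsDensity N T x := by
          rw [e2, mul_assoc]
  · exact ((hint k).const_mul (((k + 1 : ℕ) : ℝ))).congr
      (Filter.Eventually.of_forall fun x => by simp only [Nat.add_sub_cancel]; ring)
  · exact ((hint (k + 2)).const_mul (-T⁻¹)).congr (Filter.Eventually.of_forall fun x => by simp only; ring)
  · exact hint (k + 1)

end Pinned

end Summit.AtomisticToContinuum.FouriersLaw.Theorems.NoOddCharge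

end
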